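import Literature.MathematicalPhysics.QuantumFieldTheory.Balaban1983to89.B9Thm313WholeBlocksPairM
import Literature.MathematicalPhysics.QuantumFieldTheory.Balaban1983to89.B9Thm313WholeDirInputB

/-!
# `Balaban1983to89.B9Thm313WholeBlocksPairMB` — [B9] Theorem 3.13 (p. 426): the Hölder block (3.43)–(3.45) of 𝔊's kernel family on the pair family
# WITH β∕ε-INDEXED STEP AND INPUT-LETTER CONSTANTS (the twin of `B9Thm313WholeBlocksPairM.GG_holder_pairM` for the reshaped schemas
# `B9Thm312WholeDirB.StepDirB` and `B9Thm313WholeDirInputB.Letters313IMB`; located remarks U2 ∕ U3, referee WATCH-A6-N06-STEPDIR-EPSUNIFORM)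

T. Bałaban, *Propagators for lattice gauge theories in a background field*, Commun. Math. Phys. **99** (1985) 389–434
[`Balaban1985BackgroundPropagators`, "B9"]; [4] = T. Bałaban, *Propagators and renormalization transformations for lattice gauge
theories. II*, Commun. Math. Phys. **96** (1984) 223–250 [`Balaban1984PropagatorsII`].

statement-level skeleton of published theorems with citation tags; proofs where landed; nothing here is a claim about the Yang–Mills
mass gap

THE POINT.  `GG_holder_pairM` reads the step schema `StepDir` (one θ_H′) and the input letters `Letters313IM` (one θ_v′, one B_r) and uniformises
them by numbers t_H, t_V.  THIS FILE re-proves the block against `StepDirB` (θ_H′(β), θ_I′(ε)) and `Letters313IMB` (θ_v′(ε), B_r(ε)) with the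
uniformising letters AS FUNCTIONS t_H(β), t_I(ε), t_V(ε) (pointwise θ′ ≦ t): the output families become β∕ε-dependent exactly where print's B₀(β),
B′₀(ε), B′₀(ε,β) are (Theorem 3.1 p. 397), the (3.45) member reading the probe step at β and the input step at β + ε through
t_M = max(t_H β, t_I (β+ε)).  Proof VERBATIM `GG_holder_pairM`'s.  COUNT-NEUTRAL; N06 is NOT discharged; one finite lattice at a time; nothing
continuum, nothing about the mass gap.  Cell `pub-ymgap` (HUMAN RULING D-0062), Track A node N06 [B9], rows 20–21 (bundle F7), seat
`pub-ymgap-dag-n06-l` (g12), 2026-08-27.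
-/

namespace Literature.MathematicalPhysics.QuantumFieldTheory.Balaban1983to89.B9Thm313WholeBlocksPairMB

open Literature.MathematicalPhysics.QuantumFieldTheory.Balaban1983to89
open Finset B6RandomWalk B6RandomWalkHom B9Thm34Ext B9Thm37GlueCor36 B11SectG B9SectDSup
open B9Thm37AllNorms B9Thm37AllNormsInstances B9FromB6 B9SectBStepWhole B9Thm312Whole B9Thm312WholeLeaf
open B9Thm312WholeLeft B9Thm313Whole B9Thm313WholeLeft
open B9Thm37Glue B9SectDL2Decay B9RWSums343Holder B9RWSumsReadsRel B9RWSumsReadsNbr B9Ineq347 B9Thm312WholeClasses B9Thm312WholeL2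
open B9Thm312WholeBlocksRel B9Thm312WholeBlocksNbr B9Thm312WholeHolder B9Thm312WholeHHolder B9Thm313WholeHolder B9Thm313WholeL2G
open B9Thm313WholeL2GP B9Thm313WholeInput B9RWSums346SecondDiff B9Thm313WholeBlocksNbr B9Thm312WholeBlocksNbrRec B9Thm313WholeBlocksNbrRec
open B9RWSums344InputFam B9Thm312WholeDir B9Thm312WholeBlocksPairM B9Thm313WholeDir B9Thm313WholeDirInput B9Thm313WholeBlocksPairM
open B9Thm312WholeDirB B9Thm313WholeDirInputB

noncomputable section

section OneMember

variable {g : B9.Geometry} {B : B9.Backgrounds} {X Y Z W PX PY P : Type}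
variable [Fintype X] [Fintype Y] [Fintype Z] [Fintype W] [Fintype PX] [Fintype PY] [Fintype P] [Fintype g.Site] [DecidableEq g.Site]
variable {R₀ : ℝ} {H₀ : Prop}

omit [Fintype X] [Fintype Y] [Fintype Z] [Fintype W] [Fintype PX] [Fintype PY] [Fintype P] [Fintype g.Site] [DecidableEq g.Site] in
/-- the polynomial of `constI44` is monotone in (A₁, A₃, θ′, θ_H, θ_v, Λ, κ) for non-negative data (verbatim the sibling's private lemma).
[cite: Balaban1985BackgroundPropagators, Thm 3.13 p.426 (bookkeeping)] -/
private theorem polyI44_le'' {Bi Bd B₀ B₃ Br c A₁ A₁' A₃ A₃' t' T' tH TH tv TV Λ Λ' κ κ' : ℝ} (hBd : 0 ≤ Bd) (hB₀ : 0 ≤ B₀)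
    (hB₃ : 0 ≤ B₃) (hBr : 0 ≤ Br) (hc : 0 ≤ c) (hA₁ : 0 ≤ A₁) (hA₁' : A₁ ≤ A₁') (hA₃ : 0 ≤ A₃) (hA₃' : A₃ ≤ A₃') (ht' : 0 ≤ t')
    (hT' : t' ≤ T') (htH : 0 ≤ tH) (hTH : tH ≤ TH) (htv : 0 ≤ tv) (hTV : tv ≤ TV) (hΛ : 0 ≤ Λ) (hΛ' : Λ ≤ Λ') (hκ : 0 ≤ κ)
    (hκ' : κ ≤ κ') :
    (Bi + (B₀ + t' * A₁ * c) * Λ * tH * c) + κ * (Bd + (B₀ + t' * A₁ * c) * Λ * tv * c) * Br * c +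
        (B₃ + t' * A₃ * c) * Λ * (B₃ * (B₃ * A₁ * c) * c) * c ≤
      (Bi + (B₀ + T' * A₁' * c) * Λ' * TH * c) + κ' * (Bd + (B₀ + T' * A₁' * c) * Λ' * TV * c) * Br * c +
        (B₃ + T' * A₃' * c) * Λ' * (B₃ * (B₃ * A₁' * c) * c) * c := by
  have hA₁'0 : 0 ≤ A₁' := hA₁.trans hA₁'
  have hA₃'0 : 0 ≤ A₃' := hA₃.trans hA₃'
  have hT'0 : 0 ≤ T' := ht'.trans hT'
  have hTH0 : 0 ≤ TH := htH.trans hTH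
  have hTV0 : 0 ≤ TV := htv.trans hTV
  have hΛ'0 : 0 ≤ Λ' := hΛ.trans hΛ'
  have hκ'0 : 0 ≤ κ' := hκ.trans hκ'
  have h1 : (B₀ + t' * A₁ * c) * Λ * tH * c ≤ (B₀ + T' * A₁' * c) * Λ' * TH * c := by gcongr
  have h2 : κ * (Bd + (B₀ + t' * A₁ * c) * Λ * tv * c) * Br * c ≤ κ' * (Bd + (B₀ + T' * A₁' * c) * Λ' * TV * c) * Br * c := by
    gcongr
  have h3 : (B₃ + t' * A₃ * c) * Λ * (B₃ * (B₃ * A₁ * c) * c) * c ≤ (B₃ + T' * A₃' * c) * Λ' * (B₃ * (B₃ * A₁' * c) * c) * c := by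
    gcongr
  linarith

omit [Fintype X] [Fintype Y] [Fintype Z] [Fintype W] [Fintype PX] [Fintype PY] [Fintype P] [Fintype g.Site] [DecidableEq g.Site] in
/-- the polynomial of `constI45` is monotone in (A₁, A₃, θ_H, θ_v, Λ, κ) for non-negative data (verbatim the sibling's private lemma).
[cite: Balaban1985BackgroundPropagators, Thm 3.13 p.426 (bookkeeping)] -/
private theorem polyI45_le'' {Bi2 Bd2 Bh Bq B₀ B₃ Br c A₁ A₁' A₃ A₃' tH TH tv TV Λ Λ' κ κ' : ℝ} (hBd2 : 0 ≤ Bd2) (hBh : 0 ≤ Bh)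
    (hBq : 0 ≤ Bq) (hB₃ : 0 ≤ B₃) (hBr : 0 ≤ Br) (hc : 0 ≤ c) (hA₁ : 0 ≤ A₁) (hA₁' : A₁ ≤ A₁') (hA₃ : 0 ≤ A₃) (hA₃' : A₃ ≤ A₃')
    (htH : 0 ≤ tH) (hTH : tH ≤ TH) (htv : 0 ≤ tv) (hTV : tv ≤ TV) (hΛ : 0 ≤ Λ) (hΛ' : Λ ≤ Λ') (hκ : 0 ≤ κ) (hκ' : κ ≤ κ')
    (_hB₀ : 0 ≤ B₀) :
    (Bi2 + (Bh + tH * A₁ * c) * Λ * tH * c) + κ * (Bd2 + (Bh + tH * A₁ * c) * Λ * tv * c) * Br * c +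
        (Bq + tH * A₃ * c) * Λ * (B₃ * (B₃ * A₁ * c) * c) * c ≤
      (Bi2 + (Bh + TH * A₁' * c) * Λ' * TH * c) + κ' * (Bd2 + (Bh + TH * A₁' * c) * Λ' * TV * c) * Br * c +
        (Bq + TH * A₃' * c) * Λ' * (B₃ * (B₃ * A₁' * c) * c) * c := by
  have hA₁'0 : 0 ≤ A₁' := hA₁.trans hA₁'
  have hA₃'0 : 0 ≤ A₃' := hA₃.trans hA₃'
  have hTH0 : 0 ≤ TH := htH.trans hTH
  have hTV0 : 0 ≤ TV := htv.trans hTV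
  have hΛ'0 : 0 ≤ Λ' := hΛ.trans hΛ'
  have hκ'0 : 0 ≤ κ' := hκ.trans hκ'
  have h1 : (Bh + tH * A₁ * c) * Λ * tH * c ≤ (Bh + TH * A₁' * c) * Λ' * TH * c := by gcongr
  have h2 : κ * (Bd2 + (Bh + tH * A₁ * c) * Λ * tv * c) * Br * c ≤ κ' * (Bd2 + (Bh + TH * A₁' * c) * Λ' * TV * c) * Br * c := by
    gcongr
  have h3 : (Bq + tH * A₃ * c) * Λ * (B₃ * (B₃ * A₁ * c) * c) * c ≤ (Bq + TH * A₃' * c) * Λ' * (B₃ * (B₃ * A₁' * c) * c) * c := by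
    gcongr
  linarith

omit [Fintype X] [Fintype Y] [Fintype Z] [Fintype W] [Fintype PX] [Fintype PY] [Fintype P] [Fintype g.Site] [DecidableEq g.Site] in
/-- `constH313` is monotone in every constant but B₃, c (for non-negative data) (verbatim the sibling's private lemma).
[cite: Balaban1985BackgroundPropagators, Thm 3.13 p.426 (bookkeeping)] -/
private theorem constH313_mono₅ {CL CL' θ' θ'' A₁ A₁' A₃ A₃' B₃ Bd Bd' Bq Bq' κW κW' c : ℝ} (hL' : CL ≤ CL') (hθ : 0 ≤ θ')
    (hθ'' : θ' ≤ θ'') (h₁ : 0 ≤ A₁) (h₁' : A₁ ≤ A₁') (h₃ : 0 ≤ A₃) (h₃' : A₃ ≤ A₃') (hB : 0 ≤ B₃) (hd : 0 ≤ Bd) (hd' : Bd ≤ Bd')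
    (hq : 0 ≤ Bq) (hq' : Bq ≤ Bq') (hκ : 0 ≤ κW) (hκ' : κW ≤ κW') (hc : 0 ≤ c) :
    constH313 CL θ' A₁ A₃ B₃ Bd Bq κW c ≤ constH313 CL' θ'' A₁' A₃' B₃ Bd' Bq' κW' c := by
  unfold constH313
  have hθ''0 : 0 ≤ θ'' := hθ.trans hθ''
  have hA₃'0 : 0 ≤ A₃' := h₃.trans h₃'
  have hd'0 : 0 ≤ Bd' := hd.trans hd'
  have hκ'0 : 0 ≤ κW' := hκ.trans hκ'
  have hq'0 : 0 ≤ Bq' := hq.trans hq'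
  have e2 : κW * Bd * B₃ * c ≤ κW' * Bd' * B₃ * c := by gcongr
  have e3 : θ' * (A₃ * B₃ * c) * c ≤ θ'' * (A₃' * B₃ * c) * c := by gcongr
  have e4 : Bq * (B₃ * (B₃ * A₁ * c) * c) * c ≤ Bq' * (B₃ * (B₃ * A₁' * c) * c) * c := by gcongr
  have e5 : θ' * (A₃ * (B₃ * (B₃ * A₁ * c) * c) * c) * c ≤ θ'' * (A₃' * (B₃ * (B₃ * A₁' * c) * c) * c) * c := by gcongr
  linarith

-- heartbeat budget: as the sibling `GG_holder_pairM` (one-block proof in the 130–160k band on the farm).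
set_option maxHeartbeats 400000 in
/-- ★ **THEOREM 3.13 — THE HÖLDER BLOCK (3.43)–(3.45) OF 𝔊's KERNEL FAMILY ON THE PAIR FAMILY, β∕ε-INDEXED STEP ∕ LETTER CONSTANTS** (B-twin of `GG_holder_pairM`: `StepDirB`, `Letters313IMB`, uniformising letters t_H(β), t_I(ε), t_V(ε) pointwise, t_M = max(t_H β, t_I (β+ε)) in the (3.45) member; otherwise as the original: the
twin of `…BlocksNbr.GG_holder_nbr` with the (3.44)∕(3.45) co-reading moved to `InputReadsFam … (blk ∘ Prod.fst) (blkPX ∘ Prod.fst) (fun β => sliceProbe (Φ^X_β U))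
ev (familyOp (q ↦ ∇_{U,q.1} ∘ 𝔊 ∘ ∇\*_{U,q.2}))`).  (3.43) from the two probe majorants of (3.153) (`GG_probe43L∕R_of_letters`: Theorem 3.3's probes for G₀ —
`Thm33G0Dir.h43L∕h43R` —, the Hölder step `StepDir.pY1∕pX1`, the letters `LettersHH.pQ`, `Letters313H`, `Letters313D.rgdH`) read through `H1ReadsNbr`;
(3.44)∕(3.45) from `GG_input44Family∕45Family_of_letters` (the direction-indexed schemas `Thm33G0Dir ∕ Thm33G0DirR ∕ StepDir` and letters `Letters313DM ∕
Letters313IM`) read through `InputReadsFam`; the member constants brought to the family-uniform expressions ((1 − θc)⁻¹ ≦ 2, θ_D′ ≦ t_D, θ_H′ ≦ t_H, θ_V′ ≦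
t_V, Λ ≦ Λ_u, κ ≦ κ_u), then `B9Thm312WholeBlocksPairM.ineq343_345_of_majorants_pairM` at the rate ρ₄ (ρ₄ + 3σ ≦ (1 − α)ρ′).  Nothing of print asserted.
[cite: Balaban1985BackgroundPropagators, Thm 3.13 p.426 + (3.152)–(3.153) p.426 + (3.43)–(3.45) p.398 + (3.39)–(3.40) p.397 + Thm 3.12 p.423; Balaban1984PropagatorsII, (2.51)–(2.52) p.232 + Lemma 2.1 (2.60)–(2.61) p.234] -/
theorem GG_holder_pairMB (hG : GeoOK g) (𝔭 : HolderProbes g B X Y PX PY) (K : B9.KernelFamily g B) {𝔬 : Ops g B X Y Z W} {U : B.Cfg}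
    {Dd Dds : B.Cfg → P → Module.End ℝ (X → ℝ)}
    {bHX : ℝ → BlockNorm (toB6 g R₀ H₀) (X → ℝ)} {bHW : ℝ → BlockNorm (toB6 g R₀ H₀) (W → ℝ)} {bH : BlockNorm (toB6 g R₀ H₀) (W → ℝ)}
    (Rel : g.Site → g.Site → Prop) [DecidableRel Rel] {ev : g.Loc → X → ℝ} {evY : g.Loc → Y → ℝ} {m : ℕ}
    {r CL θ θD' tD B₀ B₃ Λ Λu κu ρ ρ' ρ₄ α σ c δ₀ δ₃ δK : ℝ} {θH' θI' θv' tH tI tV Br Bh Bi Bq Bd BhD Bx : ℝ → ℝ} {Bi2 Bd2 : ℝ → ℝ → ℝ}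
    (hrow : RowSum (toB6 g R₀ H₀) σ c) (hc : 0 ≤ c) (hθ : 0 ≤ θ) (hθD' : 0 ≤ θD') (hθH' : ∀ β, 0 ≤ β → β < 1 → 0 ≤ θH' β)
    (hθI' : ∀ ε, 0 < ε → 0 ≤ θI' ε) (hθv' : ∀ ε, 0 < ε → 0 ≤ θv' ε)
    (hθD'le : θD' ≤ tD) (hθH'le : ∀ β, 0 ≤ β → β < 1 → θH' β ≤ tH β) (hθI'le : ∀ ε, 0 < ε → θI' ε ≤ tI ε)
    (hθv'le : ∀ ε, 0 < ε → θv' ε ≤ tV ε) (hB₀ : 0 ≤ B₀) (hB₃ : 0 ≤ B₃) (hBr : ∀ ε, 0 < ε → 0 ≤ Br ε) (hq : θ * c ≤ 1 / 2)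
    (hBh : ∀ β, 0 ≤ β → β < 1 → 0 ≤ Bh β) (hBi : ∀ ε, 0 < ε → ε ≤ 1 → 0 ≤ Bi ε) (hBq : ∀ β, 0 ≤ β → β < 1 → 0 ≤ Bq β)
    (hBd : ∀ ε, 0 < ε → ε ≤ 1 → 0 ≤ Bd ε) (hBi2 : ∀ ε β, 0 < ε → ε ≤ 1 → 0 ≤ β → β < 1 → 0 ≤ Bi2 ε β)
    (hBd2 : ∀ ε β, 0 < ε → ε ≤ 1 → 0 ≤ β → β < 1 → 0 ≤ Bd2 ε β) (hBhD : ∀ β, 0 ≤ β → β < 1 → 0 ≤ BhD β)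
    (hBx : ∀ β, 0 ≤ β → β < 1 → 0 ≤ Bx β) (hΛ0 : 0 ≤ Λ) (hΛle : Λ ≤ Λu)
    (hκ : bH.κ ≤ κu) (hκW : ∀ ε, (bHW ε).κ ≤ κu) (h1κ : 1 ≤ κu) (hα0 : 0 ≤ α) (hσ : 0 ≤ σ) (hρ' : 0 < ρ') (hρ'ρ : ρ' + 3 * σ ≤ ρ)
    (hρ₄0 : 0 ≤ ρ₄) (hρ₄r : ρ₄ + 3 * σ ≤ (1 - α) * ρ') (hρS : ρ ≤ δ₀) (hρ₃ : ρ ≤ δ₃) (hρδ : ρ + σ ≤ δK)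
    (hρ'0 : ρ' ≤ δ₀) (hρ'₃ : ρ' ≤ δ₃) (hρ'K : ρ' + σ ≤ δK) (hST : ScaleTransfer g ρ' α Λ (fun y => g.len y ^ (1 : ℝ)))
    (he0 : HasMajorant (g := toB6 g R₀ H₀) 𝔬.blk (𝔬.G0 U) (fun a b => B₀ * g.len a ^ 2 * Real.exp (-(δ₀ * g.dist a b))))
    (he2 : HasMajorantHom (g := toB6 g R₀ H₀) 𝔬.blkY 𝔬.blk (𝔬.G0 U ∘ₗ 𝔬.Dstar U)
      (fun (a b : g.Site) => B₀ * g.len a * Real.exp (-(δ₀ * g.dist a b))))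
    (hK1 : HasMaj (cNorm R₀ H₀ 𝔬.blk hG.lenle 1) (cNorm R₀ H₀ 𝔬.blk hG.lenle 1) (𝔬.G0 U ∘ₗ (𝔬.Tpi U + 𝔬.T2 U))
      (fun a b => θ * Real.exp (-(δK * g.dist a b))))
    (hK2 : HasMaj (cNorm R₀ H₀ 𝔬.blk hG.lenle 2) (cNorm R₀ H₀ 𝔬.blk hG.lenle 2) (𝔬.G0 U ∘ₗ (𝔬.Tpi U + 𝔬.T2 U))
      (fun a b => θ * Real.exp (-(δK * g.dist a b))))
    (hH0 : Thm33G0Dir 𝔬 𝔭 Dd Dds R₀ H₀ bHX B₀ Bh Bi Bi2 δ₀ U) (hHR : Thm33G0DirR 𝔬 Dds R₀ H₀ B₀ δ₀ U)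
    (hStD : StepDirB 𝔬 𝔭 Dd Dds R₀ H₀ bHX hG.lenle θD' θH' θI' δK U) (hHH : LettersHH 𝔬 𝔭 R₀ H₀ hG.lenle Bq δ₃ U)
    (hH3 : Letters313H 𝔬 𝔭 R₀ H₀ hG.lenle bH BhD Bx δ₃ U)
    (hL : Letters313 𝔬 R₀ H₀ hG B₃ δ₃ U) (hLD : Letters313D 𝔬 R₀ H₀ hG B₃ δ₃ bH U)
    (hLDM : Letters313DM 𝔬 𝔭 Dd R₀ H₀ hG B₃ Bq δ₃ bH U)
    (hLIM : Letters313IMB 𝔬 𝔭 Dd Dds R₀ H₀ hG.lenle bHX bHW Br θv' Bd Bd2 δ₃ δK U) (hI : Identities 𝔬 U)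
    (hRd₂ : ∀ a b b', Rel b b' → g.dist a b = g.dist a b')
    (hmult : ∀ y' : g.Site, (Finset.univ.filter (fun y'' => Rel y'' y')).card ≤ m)
    (hCL1 : 1 ≤ CL) (hCL : ∀ a a' : g.Site, g.dist a a' ≤ r → g.len a ≤ CL * g.len a')
    (hH1 : H1ReadsNbr K U 𝔭 Rel r 𝔬.blk 𝔬.blkY ev evY (𝔬.D U ∘ₗ 𝔬.GG U) (𝔬.GG U ∘ₗ 𝔬.Dstar U))
    (hIn : InputReadsFam K U bHX r (𝔬.blk ∘ Prod.fst) (𝔭.blkPX ∘ Prod.fst) (fun β => sliceProbe (𝔭.ΦX U β)) ev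
      (familyOp (fun q : P × P => Dd U q.1 ∘ₗ (𝔬.GG U ∘ₗ Dds U q.2)))) :
    B9.Ineq343_345 K
      (fun β => m * CL * Real.exp (r * ρ₄) *
        constH313 (Bh β + tH β * (2 * B₀) * c) (tH β) (2 * B₀) (2 * B₃) B₃ (max (BhD β) (Bx β)) (max (Bq β) (Bx β)) κu c)
      (fun ε => Real.exp (r * ρ₄) * ((Bi ε + (B₀ + tD * (2 * B₀) * c) * Λu * tI ε * c) +
        κu * (Bd ε + (B₀ + tD * (2 * B₀) * c) * Λu * tV ε * c) * Br ε * c +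
        (B₃ + tD * (2 * B₃) * c) * Λu * (B₃ * (B₃ * (2 * B₀) * c) * c) * c))
      (fun ε β => CL * Real.exp (r * ρ₄) *
        ((Bi2 ε β + (Bh β + max (tH β) (tI (β + ε)) * (2 * B₀) * c) * Λu * max (tH β) (tI (β + ε)) * c) +
        κu * (Bd2 ε β + (Bh β + max (tH β) (tI (β + ε)) * (2 * B₀) * c) * Λu * tV (β + ε) * c) * Br (β + ε) * c +
        (Bq β + max (tH β) (tI (β + ε)) * (2 * B₃) * c) * Λu * (B₃ * (B₃ * (2 * B₀) * c) * c) * c)) ρ₄ U := by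
  -- adapted from `B9Thm313WholeBlocksNbr.GG_holder_nbr` ((3.44)∕(3.45) on the pair family)
  have hq1 : θ * c < 1 := lt_one_of_le_half hq
  have hinv0 : 0 ≤ (1 - θ * c)⁻¹ := inv_nonneg.mpr (by linarith)
  have hA₁ : 0 ≤ B₀ * (1 - θ * c)⁻¹ := mul_nonneg hB₀ hinv0
  have hA₃ : 0 ≤ B₃ * (1 - θ * c)⁻¹ := mul_nonneg hB₃ hinv0
  have hA₁le : B₀ * (1 - θ * c)⁻¹ ≤ 2 * B₀ := const_le_two_mul hB₀ hq
  have hA₃le : B₃ * (1 - θ * c)⁻¹ ≤ 2 * B₃ := const_le_two_mul hB₃ hq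
  have hκu0 : 0 ≤ κu := zero_le_one.trans h1κ
  have htD0 : 0 ≤ tD := hθD'.trans hθD'le
  have htH0 : ∀ β, 0 ≤ β → β < 1 → 0 ≤ tH β := fun β h0 h1 => (hθH' β h0 h1).trans (hθH'le β h0 h1)
  have htI0 : ∀ ε, 0 < ε → 0 ≤ tI ε := fun ε hε => (hθI' ε hε).trans (hθI'le ε hε)
  have htV0 : ∀ ε, 0 < ε → 0 ≤ tV ε := fun ε hε => (hθv' ε hε).trans (hθv'le ε hε)
  -- the common constant of the (3.45) member: probe step at β, input step at β + ε
  have hθM : ∀ ε β, 0 < ε → 0 ≤ β → β < 1 → 0 ≤ max (θH' β) (θI' (β + ε)) := fun ε β hε h0 h1 =>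
    le_max_of_le_left (hθH' β h0 h1)
  have hθMle : ∀ ε β, 0 < ε → 0 ≤ β → β < 1 → max (θH' β) (θI' (β + ε)) ≤ max (tH β) (tI (β + ε)) := fun ε β hε h0 h1 =>
    max_le_max (hθH'le β h0 h1) (hθI'le (β + ε) (by linarith))
  have htM0 : ∀ ε β, 0 < ε → 0 ≤ β → β < 1 → 0 ≤ max (tH β) (tI (β + ε)) := fun ε β hε h0 h1 =>
    (hθM ε β hε h0 h1).trans (hθMle ε β hε h0 h1)
  have hΛu0 : 0 ≤ Λu := hΛ0.trans hΛle
  have h2B₀ : 0 ≤ 2 * B₀ := mul_nonneg zero_le_two hB₀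
  have h2B₃ : 0 ≤ 2 * B₃ := mul_nonneg zero_le_two hB₃
  have hlen := hG.lenle
  have hρ₄ρ' : ρ₄ ≤ ρ' := by
    have h1 : (1 - α) * ρ' = ρ' - α * ρ' := by ring
    linarith [mul_nonneg hα0 hρ'.le]
  have hexp : ∀ a b : g.Site, Real.exp (-(ρ' * g.dist a b)) ≤ Real.exp (-(ρ₄ * g.dist a b)) := fun a b =>
    Real.exp_le_exp.mpr (neg_le_neg (mul_le_mul_of_nonneg_right hρ₄ρ' (hG.dnn a b)))
  -- the (3.43) constant, uniformised
  set Cu : ℝ → ℝ := fun β => constH313 (Bh β + tH β * (2 * B₀) * c) (tH β) (2 * B₀) (2 * B₃) B₃ (max (BhD β) (Bx β))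
    (max (Bq β) (Bx β)) κu c with hCu
  have hCuL : ∀ β, 0 ≤ β → β < 1 →
      constH313 (Bh β + θH' β * (B₀ * (1 - θ * c)⁻¹) * c) (θH' β) (B₀ * (1 - θ * c)⁻¹) (B₃ * (1 - θ * c)⁻¹) B₃ (BhD β) (Bq β) bH.κ c ≤
        Cu β := by
    intro β h0 h1
    have hCL' : Bh β + θH' β * (B₀ * (1 - θ * c)⁻¹) * c ≤ Bh β + tH β * (2 * B₀) * c := by
      have := mul_le_mul_of_nonneg_right (mul_le_mul (hθH'le β h0 h1) hA₁le hA₁ (htH0 β h0 h1)) hc; linarith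
    exact constH313_mono₅ hCL' (hθH' β h0 h1) (hθH'le β h0 h1) hA₁ hA₁le hA₃ hA₃le hB₃ (hBhD β h0 h1) (le_max_left _ _) (hBq β h0 h1)
      (le_max_left _ _) bH.κ_nonneg hκ hc
  have hCuR : ∀ β, 0 ≤ β → β < 1 →
      constH313 (Bh β + θH' β * (B₀ * (1 - θ * c)⁻¹) * c) (θH' β) (B₀ * (1 - θ * c)⁻¹) (B₃ * (1 - θ * c)⁻¹) B₃ (Bx β) (Bx β) 1 c ≤
        Cu β := by
    intro β h0 h1
    have hCL' : Bh β + θH' β * (B₀ * (1 - θ * c)⁻¹) * c ≤ Bh β + tH β * (2 * B₀) * c := by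
      have := mul_le_mul_of_nonneg_right (mul_le_mul (hθH'le β h0 h1) hA₁le hA₁ (htH0 β h0 h1)) hc; linarith
    exact constH313_mono₅ hCL' (hθH' β h0 h1) (hθH'le β h0 h1) hA₁ hA₁le hA₃ hA₃le hB₃ (hBx β h0 h1) (le_max_right _ _) (hBx β h0 h1)
      (le_max_right _ _) zero_le_one h1κ hc
  have hCu0 : ∀ β, 0 ≤ β → β < 1 → 0 ≤ Cu β := fun β h0 h1 =>
    (constH313_nonneg (add_nonneg (hBh β h0 h1) (mul_nonneg (mul_nonneg (hθH' β h0 h1) hA₁) hc)) (hθH' β h0 h1) hA₁ hA₃ hB₃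
      (hBx β h0 h1) (hBx β h0 h1) zero_le_one hc).trans (hCuR β h0 h1)
  -- the two (3.43) probe majorants of 𝔊, at the rate ρ₄ (one-slot, unchanged)
  have hL43 : ∀ β, 0 ≤ β → β < 1 → HasMajorantHom (g := toB6 g R₀ H₀) 𝔬.blk 𝔭.blkPY (𝔭.ΦY U β ∘ₗ (𝔬.D U ∘ₗ 𝔬.GG U))
      (fun (a b : g.Site) => Cu β * g.len a ^ (1 - β) * Real.exp (-(ρ₄ * g.dist a b))) := by
    intro β h0 h1
    have h := GG_probe43L_of_letters hG 𝔭 hrow hc hθ (hθH' β h0 h1) hB₀ hB₃ (hBh β h0 h1) (hBq β h0 h1) (hBhD β h0 h1) hσ hρ'.le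
      hρ'ρ hρS hρ₃ hρδ hq1 hK2 he0 (hH0.h43L β h0 h1) (hStD.pY1 β h0 h1) (hHH.pQ β h0 h1) (hH3.pYDH β h0 h1) hL hLD.rgdH hI
    exact hasMajorantHom_mono (g := toB6 g R₀ H₀) 𝔬.blk 𝔭.blkPY h fun a b =>
      mul_le_mul (mul_le_mul_of_nonneg_right (hCuL β h0 h1) (Real.rpow_nonneg (hlen a) _)) (hexp a b) (Real.exp_nonneg _)
        (mul_nonneg (hCu0 β h0 h1) (Real.rpow_nonneg (hlen a) _))
  have hR43 : ∀ β, 0 ≤ β → β < 1 → HasMajorantHom (g := toB6 g R₀ H₀) 𝔬.blkY 𝔭.blkPX (𝔭.ΦX U β ∘ₗ (𝔬.GG U ∘ₗ 𝔬.Dstar U))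
      (fun (a b : g.Site) => Cu β * g.len a ^ (1 - β) * Real.exp (-(ρ₄ * g.dist a b))) := by
    intro β h0 h1
    have h := GG_probe43R_of_letters hG 𝔭 hrow hc hθ (hθH' β h0 h1) hB₀ hB₃ (hBh β h0 h1) (hBx β h0 h1) hσ hρ'.le hρ'ρ hρS hρ₃ hρδ
      hq1 hK1 he2 (hH0.h43R β h0 h1) (hStD.pX1 β h0 h1) (hH3.pXDv β h0 h1) (hH3.pXQs β h0 h1) hL hI
    exact hasMajorantHom_mono (g := toB6 g R₀ H₀) 𝔬.blkY 𝔭.blkPX h fun a b =>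
      mul_le_mul (mul_le_mul_of_nonneg_right (hCuR β h0 h1) (Real.rpow_nonneg (hlen a) _)) (hexp a b) (Real.exp_nonneg _)
        (mul_nonneg (hCu0 β h0 h1) (Real.rpow_nonneg (hlen a) _))
  -- the (3.44), (3.45) input majorants of 𝔊 on the pair family at the rate ρ₄, constants uniformised
  have h44 : ∀ ε, 0 < ε → ε ≤ 1 → HasMaj (bHX ε) (BlockNorm.ofBlocks (toB6 g R₀ H₀) (𝔬.blk ∘ Prod.fst))
      (familyOp (fun q : P × P => Dd U q.1 ∘ₗ (𝔬.GG U ∘ₗ Dds U q.2)))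
      (fun (a b : g.Site) => ((Bi ε + (B₀ + tD * (2 * B₀) * c) * Λu * tI ε * c) +
        κu * (Bd ε + (B₀ + tD * (2 * B₀) * c) * Λu * tV ε * c) * Br ε * c +
        (B₃ + tD * (2 * B₃) * c) * Λu * (B₃ * (B₃ * (2 * B₀) * c) * c) * c) * Real.exp (-(ρ₄ * g.dist a b))) := by
    intro ε h0 h1
    have h := GG_input44Family_of_lettersB hG 𝔭 hrow hc hθ hθD' (hθI' ε h0) (hθv' ε h0) hB₀ hB₃ (hBi ε h0 h1) (hBd ε h0 h1) (hBr ε h0)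
      hΛ0 hα0 hσ h0 h1 hρ₄0 hρ₄r hρ'.le hρ'0 hρ'₃ hρ'K hq1 hST hK1 hK2 he0 hH0 hHR hStD hL hLDM hLIM hI
    refine h.mono fun a b => mul_le_mul_of_nonneg_right ?_ (Real.exp_nonneg _)
    unfold constI44
    exact polyI44_le'' (hBd ε h0 h1) hB₀ hB₃ (hBr ε h0) hc hA₁ hA₁le hA₃ hA₃le hθD' hθD'le (hθI' ε h0) (hθI'le ε h0) (hθv' ε h0)
      (hθv'le ε h0) hΛ0 hΛle (bHW ε).κ_nonneg (hκW ε)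
  have h45 : ∀ ε β, 0 < ε → ε ≤ 1 → 0 ≤ β → β < 1 →
      HasMaj (bHX (β + ε)) (BlockNorm.ofBlocks (toB6 g R₀ H₀) (𝔭.blkPX ∘ Prod.fst))
      (sliceProbe (𝔭.ΦX U β) ∘ₗ familyOp (fun q : P × P => Dd U q.1 ∘ₗ (𝔬.GG U ∘ₗ Dds U q.2)))
      (fun (a b : g.Site) => ((Bi2 ε β + (Bh β + max (tH β) (tI (β + ε)) * (2 * B₀) * c) * Λu * max (tH β) (tI (β + ε)) * c) +
        κu * (Bd2 ε β + (Bh β + max (tH β) (tI (β + ε)) * (2 * B₀) * c) * Λu * tV (β + ε) * c) * Br (β + ε) * c +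
        (Bq β + max (tH β) (tI (β + ε)) * (2 * B₃) * c) * Λu * (B₃ * (B₃ * (2 * B₀) * c) * c) * c) * g.len a ^ (-β) *
        Real.exp (-(ρ₄ * g.dist a b))) := by
    intro ε β h0 h1 hb0 hb1
    have hε' : 0 < β + ε := by linarith
    have h := GG_input45Family_of_lettersB hG 𝔭 hrow hc hθ (hθH' β hb0 hb1) (hθv' (β + ε) hε') hB₀ hB₃ (hBh β hb0 hb1)
      (hBi2 ε β h0 h1 hb0 hb1) (hBq β hb0 hb1) (hBd2 ε β h0 h1 hb0 hb1) (hBr (β + ε) hε') hΛ0 hα0 hσ h0 h1 hb0 hb1 hρ₄0 hρ₄r hρ'.le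
      hρ'0 hρ'₃ hρ'K hq1 hST hK1 hK2 he0 hH0 hHR hStD hL hLDM hLIM hI
    refine h.mono fun a b => mul_le_mul_of_nonneg_right (mul_le_mul_of_nonneg_right ?_ (Real.rpow_nonneg (hG.lenle a) _))
      (Real.exp_nonneg _)
    unfold constI45
    exact polyI45_le'' (hBd2 ε β h0 h1 hb0 hb1) (hBh β hb0 hb1) (hBq β hb0 hb1) hB₃ (hBr (β + ε) hε') hc hA₁ hA₁le hA₃ hA₃le
      (hθM ε β h0 hb0 hb1) (hθMle ε β h0 hb0 hb1) (hθv' (β + ε) hε') (hθv'le (β + ε) hε') hΛ0 hΛle (bHW (β + ε)).κ_nonneg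
      (hκW (β + ε)) hB₀
  have hU44 : ∀ ε, 0 < ε → ε ≤ 1 → 0 ≤ (Bi ε + (B₀ + tD * (2 * B₀) * c) * Λu * tI ε * c) +
      κu * (Bd ε + (B₀ + tD * (2 * B₀) * c) * Λu * tV ε * c) * Br ε * c +
      (B₃ + tD * (2 * B₃) * c) * Λu * (B₃ * (B₃ * (2 * B₀) * c) * c) * c := by
    intro ε h0 h1
    have hBiε := hBi ε h0 h1
    have hBdε := hBd ε h0 h1
    have htIε := htI0 ε h0
    have htVε := htV0 ε h0
    have hBrε := hBr ε h0
    positivity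
  have hU45 : ∀ ε β, 0 < ε → ε ≤ 1 → 0 ≤ β → β < 1 →
      0 ≤ (Bi2 ε β + (Bh β + max (tH β) (tI (β + ε)) * (2 * B₀) * c) * Λu * max (tH β) (tI (β + ε)) * c) +
      κu * (Bd2 ε β + (Bh β + max (tH β) (tI (β + ε)) * (2 * B₀) * c) * Λu * tV (β + ε) * c) * Br (β + ε) * c +
      (Bq β + max (tH β) (tI (β + ε)) * (2 * B₃) * c) * Λu * (B₃ * (B₃ * (2 * B₀) * c) * c) * c := by
    intro ε β h0 h1 hb0 hb1
    have hε' : 0 < β + ε := by linarith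
    have hBi2ε := hBi2 ε β h0 h1 hb0 hb1
    have hBd2ε := hBd2 ε β h0 h1 hb0 hb1
    have hBhβ := hBh β hb0 hb1
    have hBqβ := hBq β hb0 hb1
    have htM := htM0 ε β h0 hb0 hb1
    have htVε := htV0 (β + ε) hε'
    have hBrε := hBr (β + ε) hε'
    positivity
  exact ineq343_345_of_majorants_pairM (R := R₀) (H := H₀) hG 𝔭 bHX hRd₂ hmult hCL1 hCL hCu0 hU44 hU45 hρ₄0 hL43 hR43 h44 h45 hH1 hIn

end OneMember

end

end Literature.MathematicalPhysics.QuantumFieldTheory.Balaban1983to89.B9Thm313WholeBlocksPairMB
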